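import Summits.Ventures.PercRepro.ProfilePointedCircuitClassesStarNineSplitG

/-!
# PercRepro — THE TWO-PART SPLIT OF THE DEFECT BOUND, PART H: REGIME EF3 WITH THE EXACT NO-KILL HYPOTHESIS
(p5, gen 58; `proofs/P5-GM1.md` §86 ADD 5)

Part D's theorem with part E's exact no-kill hypothesis: `f ∉ cl(A + e)` is asked only of the `C`-pair candidates
(`A ⊆ X` a pair with `A + e` independent and `X − A` a basis).  `inCount_le_of_noKill'`: (★)₉ at `(e, f)` when `e` lies on no
`3`-circuit and no candidate is killed — the regime «no kill at all» (28,147 more core instances than part D; the kernel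
now covers 98.55 % of the core, kit j337758).
-/

open scoped Matroid

namespace PercRepro.Cogirth

open Finset ThmH Skew Shadow Profile

open Classical

variable {α : Type} [DecidableEq α] {N : Matroid α} [N.Finite]

section StarNineSplitH

/-- **THE FIRST-KIND BOUND UNDER THE EXACT NO-KILL HYPOTHESIS**: `#tTwo ≤ #cPairs` when `e` is on no `3`-circuit and
every `C`-pair candidate is a `C`-pair. -/
theorem card_tTwo_le_card_cPairs_of_noKill' (hn : (gr N).card = 9)
    (hcos : ∀ x ∈ gr N, ∀ y ∈ gr N, x ≠ y → rk N (((gr N).erase x).erase y) = 5) {e f : α} (he : e ∈ gr N)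
    (hf : f ∈ gr N) (hef : e ≠ f) (he3 : ∀ A ⊆ gr N, e ∉ A → A.card = 2 → e ∉ clF N A)
    (hnk : ∀ A ⊆ ((gr N).erase e).erase f, A.card = 2 → rk N (insert e A) = 3 →
      rk N ((((gr N).erase e).erase f) \ A) = 5 → f ∉ clF N (insert e A)) :
    (tTwo N e f).card ≤ (cPairs N e f).card := by
  have hdc := sum_card_bipartiteAbove_eq_sum_card_bipartiteBelow (fun (τ π : Finset α) => π ⊆ τ)
    (s := tTwo N e f) (t := cPairs N e f)
  have hlow : (tTwo N e f).card • 2 ≤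
      ∑ τ ∈ tTwo N e f, (bipartiteAbove (fun τ π => π ⊆ τ) (cPairs N e f) τ).card := by
    apply card_nsmul_le_sum
    intro τ hτ
    unfold bipartiteAbove
    exact two_le_card_cPairs_subset_of_noKill' hn hcos he hf hef hnk hτ
  have hup : ∑ π ∈ cPairs N e f, (bipartiteBelow (fun τ π => π ⊆ τ) (tTwo N e f) π).card ≤
      (cPairs N e f).card • 2 := by
    apply sum_le_card_nsmul
    intro π hπ
    unfold bipartiteBelow
    exact card_tTwo_supset_le_two_of_three_circuit_free hn he hf hef he3 hπ
  rw [hdc] at hlow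
  have := hlow.trans hup
  simp only [smul_eq_mul] at this
  omega

/-- **(★)₉ WITH NO KILL AT ALL**: on a simple cosimple `N` with `#E = 9`, `in_4(e) ≤ in_4(f) + thru_4({e, f})` whenever `e`
lies on no `3`-circuit and every `C`-pair candidate (`A + e` independent, `X − A` a basis) has `f ∉ cl(A + e)`. -/
theorem inCount_le_of_noKill' (hn : (gr N).card = 9)
    (hsimple : ∀ x ∈ gr N, ∀ y ∈ gr N, x ≠ y → rk N {x, y} = 2)
    (hcos : ∀ x ∈ gr N, ∀ y ∈ gr N, x ≠ y → rk N (((gr N).erase x).erase y) = 5) {e f : α} (he : e ∈ gr N)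
    (hf : f ∈ gr N) (hef : e ≠ f) (he3 : ∀ A ⊆ gr N, e ∉ A → A.card = 2 → e ∉ clF N A)
    (hnk : ∀ A ⊆ ((gr N).erase e).erase f, A.card = 2 → rk N (insert e A) = 3 →
      rk N ((((gr N).erase e).erase f) \ A) = 5 → f ∉ clF N (insert e A)) :
    inCount N 4 e ≤ inCount N 4 f + thruCount N 4 {e, f} := by
  apply starNine_of_defect_bound hef
  apply defect_bound_of_tTwo_bound hn hsimple hcos he hf hef
  have := card_tTwo_le_card_cPairs_of_noKill' hn hcos he hf hef he3 hnk
  omega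

end StarNineSplitH

end PercRepro.Cogirth
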